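import Summits.RiemannHypothesis.RiemannHypothesis.Theorems.WeilLegendreBlocks136Base
import Literature.NumberTheory.LFunctions.WeilBlockRows
import Literature.NumberTheory.LFunctions.WeilBlockRowsDCFast
import HarnessLib

/-!
# Odd Legendre blocks at `nb = 136`: rows 12–15 of the check `D C = I`

`WeilCert.checkDCRow 1` for the block base `weilBlocks136Base`, row by row via the linear-traversal check `WeilCert.checkDCRowF` (`decide +kernel`) and `WeilCert.checkDCRow_of_F`. Pure proof file; nothing is asserted.
-/

noncomputable section

set_option linter.dupNamespace false

namespace Summit.RiemannHypothesis.RiemannHypothesis.Theorems.EvenWinsBeyondArch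

open Literature.NumberTheory.LFunctions

set_option maxHeartbeats 0 in
/-- Fast kernel check of row 12 of `D C = I` (odd blocks, `nb = 136`; linear traversals). [folklore] -/
theorem checkDCRowF1_12_weilBlocks136 : weilBlocks136Base.checkDCRowF 1 12 = true := by
  decide +kernel

/-- Row 12 of `D C = I` (odd blocks, `nb = 136`), from the fast check. [folklore] -/
theorem checkDCRow1_12_weilBlocks136 : weilBlocks136Base.checkDCRow 1 12 = true :=
  WeilCert.checkDCRow_of_F checkDCRowF1_12_weilBlocks136

set_option maxHeartbeats 0 in
/-- Fast kernel check of row 13 of `D C = I` (odd blocks, `nb = 136`; linear traversals). [folklore] -/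
theorem checkDCRowF1_13_weilBlocks136 : weilBlocks136Base.checkDCRowF 1 13 = true := by
  decide +kernel

/-- Row 13 of `D C = I` (odd blocks, `nb = 136`), from the fast check. [folklore] -/
theorem checkDCRow1_13_weilBlocks136 : weilBlocks136Base.checkDCRow 1 13 = true :=
  WeilCert.checkDCRow_of_F checkDCRowF1_13_weilBlocks136

set_option maxHeartbeats 0 in
/-- Fast kernel check of row 14 of `D C = I` (odd blocks, `nb = 136`; linear traversals). [folklore] -/
theorem checkDCRowF1_14_weilBlocks136 : weilBlocks136Base.checkDCRowF 1 14 = true := by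
  decide +kernel

/-- Row 14 of `D C = I` (odd blocks, `nb = 136`), from the fast check. [folklore] -/
theorem checkDCRow1_14_weilBlocks136 : weilBlocks136Base.checkDCRow 1 14 = true :=
  WeilCert.checkDCRow_of_F checkDCRowF1_14_weilBlocks136

set_option maxHeartbeats 0 in
/-- Fast kernel check of row 15 of `D C = I` (odd blocks, `nb = 136`; linear traversals). [folklore] -/
theorem checkDCRowF1_15_weilBlocks136 : weilBlocks136Base.checkDCRowF 1 15 = true := by
  decide +kernel

/-- Row 15 of `D C = I` (odd blocks, `nb = 136`), from the fast check. [folklore] -/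
theorem checkDCRow1_15_weilBlocks136 : weilBlocks136Base.checkDCRow 1 15 = true :=
  WeilCert.checkDCRow_of_F checkDCRowF1_15_weilBlocks136


end Summit.RiemannHypothesis.RiemannHypothesis.Theorems.EvenWinsBeyondArch
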